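import Summits.NavierStokesRegularity.NavierStokesRegularity.Theorems.ScenarioCensusRowF19obTop

/-!
# Census row F19 family, member F19ob «observer tops» — part 2/4: the schema row F-obs from row F1a BY NAME,
# the instances F-tw / F-acc / F-force / F1acc, observer unsteadiness, the force floor, `TypeIBallisticity ↔ Row_F1`

Re-homed for the scenario census (typer seat ns-census-typer-2 g8; lead g7 GO 2026-08-28T17:18Z: PORT of ns-idea-3 LINE 12
«observer-top» REV 2, `pub/ideators/ns-idea-3/lines/observer-top/line-observer-top.lean`, sha16 d9972826d387f45a, 924 l.,
lean check rc 0, 0 sorry; ref g7 PRE-CHECK ✓ §12.24; critic idea-crit-3 RE-STAMP CONFORMS 16:39:31Z; booked as TREE records of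
F19 family MEMBERS under ROW POLICY 15:11Z / cen9 (2), no new row), split for the 400-line rule into
`ScenarioCensusRowF19obTop` (§1–§3: instrument, rows, tools, calculus along characteristics) → `ScenarioCensusRowF19obSchema`
(§4–§5: the schema row F-obs from row F1a BY NAME, instances, structural theorems, residual) → `ScenarioCensusRowF19obSigned`
(§6: signed rows) → `ScenarioCensusRowF19ob` (census keys).  Lean text VERBATIM in namespace `…Theorems.ScenarioCensus.ObserverTop`
(the line's `…Cruxes.ScenarioCensusRowF1.ObserverTopLine` re-homed); the four real-variable tools identical to LINE 11's
(`deltaStar_pos`, `kappa_mul_lt_one`, `hasDerivAt_inv_sqrt_sub`, `norm_le_barrier`) are taken from the tree's F19 port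
(`ScenarioCensus.QuasiSteadyTop`, `ScenarioCensusRowF19Top.lean`) instead of being restated; one bib key corrected
(`Tao2013Localisation`); the `[folklore]` tags of the parameterless row `def`s dropped (gate relocation rule), as in the F19 port.

Mechanism (all in kernel): fence `s ↦ |u(s,X(s))|` along each characteristic with the barrier
`K + 2δ'√ν((T−s)^{-1/2} − (T−t₁)^{-1/2})` (`norm_le_of_quasiSteadyAlong`; chain rule through the joint derivative of
`uncurry u`; where `|u| = B > Λ` the particle is fast, so `|d/ds|u(s,X(s))|| ≤ ‖D^b u‖ < B'`); `K` = sup bound at time `t₁`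
(Tao cover) `+ Λ⁺ + 1`; the resulting small Type-I rate `(δ + 9 − 2√15)√ν` is row F1a's hypothesis
(`rowFobs_of_rowF1a`, `rowFobs_holds`); instances `rowFtw_holds`, `rowFacc_holds`, `rowFforce_holds`, `rowF1acc_holds`;
structural `observerUnsteadiness_holds`, `forceFloor_holds`; `typeIBallisticity_iff_rowF1`, `rowF1_of_typeIBallisticity`.

No census value is asserted here; NS regularity is NOT proved; `Row_F1` stays open (≡ `TypeIBallisticity`); no summit statement
is proved by this file.
-/

noncomputable section

set_option linter.dupNamespace false

open MeasureTheory Set Function Filter TopologicalSpace Metric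
open scoped Topology NNReal ENNReal Laplacian RealInnerProductSpace

namespace Summit.NavierStokesRegularity.NavierStokesRegularity.Theorems.ScenarioCensus.ObserverTop

open Literature.Analysis Literature.Analysis.FluidPDE
open Summit.NavierStokesRegularity.NavierStokesRegularity.Theorems

/-! ## §4 The schema row F-obs -/

/-- **Fencing along characteristics**: under a strict quasi-steady bound for the observer `b` at fast
points on `[t₁,T)` (`0 < t₁`), characteristics from `t₁`, and a sup bound `M` at time `t₁`, every later
slice obeys `‖u(t,x)‖ ≤ (M + Λ⁺ + 1) + 2δc((√(T−t))⁻¹ − (√(T−t₁))⁻¹)`. [folklore] -/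
theorem norm_le_of_quasiSteadyAlong {ν T t₁ Λ M δc : ℝ} {b u : ℝ → E3 → E3} {p : ℝ → E3 → ℝ}
    (hsol : IsClassicalNSSolutionOn (Ico 0 T) ν 0 u p) (ht₁ : 0 < t₁) (hδc : 0 ≤ δc)
    (hM : ∀ x, ‖u t₁ x‖ ≤ M) (hchar : HasCharacteristics b t₁ T)
    (hqs : ∀ s ∈ Ico t₁ T, ∀ x, Λ < ‖u s x‖ →
      ‖timeDerivWithin (Ico 0 T) u s x + convect (b s) (u s) x‖ <
        δc / ((T - s) * Real.sqrt (T - s))) :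
    ∀ t ∈ Ioo t₁ T, ∀ x,
      ‖u t x‖ ≤ (M + max Λ 0 + 1) + 2 * δc * ((Real.sqrt (T - t))⁻¹ - (Real.sqrt (T - t₁))⁻¹) := by
  intro t ht x
  obtain ⟨X, hXt, hXc, hXd⟩ := hchar t ht x
  have hK : Λ < M + max Λ 0 + 1 := by
    have h0 : 0 ≤ M := (norm_nonneg _).trans (hM (X t₁))
    linarith [le_max_left Λ 0]
  -- the velocity along the characteristic
  have hcont : ContinuousOn (fun s => u s (X s)) (Icc t₁ t) := by
    have hc := hsol.smooth_velocity.continuousOn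
    have hmaps : MapsTo (fun s : ℝ => ((s, X s) : ℝ × E3)) (Icc t₁ t) (Ico 0 T ×ˢ (univ : Set E3)) :=
      fun s hs => ⟨⟨ht₁.le.trans hs.1, lt_of_le_of_lt hs.2 ht.2⟩, mem_univ _⟩
    exact hc.comp (continuousOn_id.prodMk hXc) hmaps
  have hder : ∀ s ∈ Ico t₁ t, HasDerivWithinAt (fun r => u r (X r))
      (timeDerivWithin (Ico 0 T) u s (X s) + convect (b s) (u s) (X s)) (Ici s) s := by
    intro s hs
    have hs0T : s ∈ Ioo 0 T := ⟨ht₁.trans_le hs.1, hs.2.trans ht.2⟩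
    exact hasDerivWithinAt_along hsol hs0T (hXd s hs)
  have hfast : ∀ s ∈ Ico t₁ t, Λ < ‖u s (X s)‖ →
      ‖timeDerivWithin (Ico 0 T) u s (X s) + convect (b s) (u s) (X s)‖ <
        δc / ((T - s) * Real.sqrt (T - s)) := fun s hs hΛ =>
    hqs s ⟨hs.1, hs.2.trans ht.2⟩ (X s) hΛ
  have h := QuasiSteadyTop.norm_le_barrier ht.2 hδc hK hcont hder hfast ((hM (X t₁)).trans (by
    have h0 : 0 ≤ max Λ 0 := le_max_right _ _; linarith)) t ⟨ht.1.le, le_rfl⟩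
  simpa [hXt] using h

/-- **Schema row F-obs from row F1a** (BY NAME): a quasi-steady top for an admissible observer with
modulus `δ < 9 − 2√15` forces the small eventual rate `√(T−t)|u| ≤ (δ + 9 − 2√15)√ν`, and row F1a
extends the solution. [folklore] -/
theorem rowFobs_of_rowF1a (hF1a : ScenarioCensus.Row_F1a) : Row_Fobs := by
  intro ν T δ hν hT hδ hδlt b u p hsol hLH hdec hchar hqs
  obtain ⟨Λ, hev⟩ := hqs
  obtain ⟨T₀, hT₀T, hT₀⟩ := mem_nhdsLT_iff_exists_Ioo_subset.1 hev
  set t₁ : ℝ := (max T₀ 0 + T) / 2 with ht₁def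
  have ht₁0 : 0 < t₁ := by
    have : 0 ≤ max T₀ 0 := le_max_right _ _
    rw [ht₁def]; linarith
  have ht₁T : t₁ < T := by
    have : max T₀ 0 < T := max_lt hT₀T hT
    rw [ht₁def]; linarith
  have hT₀t₁ : T₀ < t₁ := by
    have h1 : T₀ ≤ max T₀ 0 := le_max_left _ _
    have h2 : max T₀ 0 < T := max_lt hT₀T hT
    rw [ht₁def]; linarith
  obtain ⟨M, hM0, hM⟩ := exists_sup_bound_at hν hT hsol hLH hdec ⟨ht₁0, ht₁T⟩
  set g : ℝ := 9 - 2 * Real.sqrt 15 - δ with hgdef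
  have hg : 0 < g := by rw [hgdef]; linarith
  have hsν : 0 < Real.sqrt ν := Real.sqrt_pos.2 hν
  set δc : ℝ := (δ + g / 4) * Real.sqrt ν with hδcdef
  have hδc : 0 ≤ δc := by rw [hδcdef]; positivity
  have hqs' : ∀ s ∈ Ico t₁ T, ∀ x, Λ < ‖u s x‖ →
      ‖timeDerivWithin (Ico 0 T) u s x + convect (b s) (u s) x‖ <
        δc / ((T - s) * Real.sqrt (T - s)) := by
    intro s hs x hΛ
    have hsT : 0 < T - s := sub_pos.2 hs.2
    have hden : 0 < (T - s) * Real.sqrt (T - s) := mul_pos hsT (Real.sqrt_pos.2 hsT)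
    have h := hT₀ ⟨hT₀t₁.trans_le hs.1, hs.2⟩ x hΛ
    refine lt_of_le_of_lt h (div_lt_div_of_pos_right ?_ hden)
    rw [hδcdef]
    have : δ < δ + g / 4 := by linarith
    exact mul_lt_mul_of_pos_right this hsν
  have hbound := norm_le_of_quasiSteadyAlong hsol ht₁0 hδc hM (hchar t₁ ⟨ht₁0, ht₁T⟩) hqs'
  set K : ℝ := M + max Λ 0 + 1 with hKdef
  have hK0 : 0 < K := by
    have : 0 ≤ max Λ 0 := le_max_right _ _
    rw [hKdef]; linarith
  set C : ℝ := δ + 9 - 2 * Real.sqrt 15 with hCdef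
  have hC0 : 0 < C := by rw [hCdef]; linarith [QuasiSteadyTop.deltaStar_pos]
  have hκC : (9 + 2 * Real.sqrt 15) / 42 * C < 1 := by rw [hCdef]; exact QuasiSteadyTop.kappa_mul_lt_one hδlt
  set ρ : ℝ := (g * Real.sqrt ν / (2 * K)) ^ 2 with hρdef
  have hρ : 0 < ρ := by rw [hρdef]; positivity
  set t₂ : ℝ := max t₁ (T - ρ) with ht₂def
  have ht₂T : t₂ < T := max_lt ht₁T (by linarith)
  have hrate : ∀ᶠ t in 𝓝[<] T, ∀ x, Real.sqrt (T - t) * ‖u t x‖ ≤ C * Real.sqrt ν := by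
    filter_upwards [Ioo_mem_nhdsLT ht₂T] with t ht x
    have ht₁t : t₁ < t := lt_of_le_of_lt (le_max_left _ _) ht.1
    have hTt : 0 < T - t := sub_pos.2 ht.2
    have hsq : 0 < Real.sqrt (T - t) := Real.sqrt_pos.2 hTt
    have h1 := hbound t ⟨ht₁t, ht.2⟩ x
    have h2 : ‖u t x‖ ≤ K + 2 * δc * (Real.sqrt (T - t))⁻¹ := by
      have hnn : 0 ≤ (Real.sqrt (T - t₁))⁻¹ := inv_nonneg.2 (Real.sqrt_nonneg _)
      have : 2 * δc * ((Real.sqrt (T - t))⁻¹ - (Real.sqrt (T - t₁))⁻¹) ≤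
          2 * δc * (Real.sqrt (T - t))⁻¹ :=
        mul_le_mul_of_nonneg_left (by linarith) (by positivity)
      rw [hKdef]; linarith
    have h3 : Real.sqrt (T - t) * ‖u t x‖ ≤ K * Real.sqrt (T - t) + 2 * δc := by
      have := mul_le_mul_of_nonneg_left h2 hsq.le
      have e : Real.sqrt (T - t) * (K + 2 * δc * (Real.sqrt (T - t))⁻¹) =
          K * Real.sqrt (T - t) + 2 * δc := by
        field_simp
      linarith [e ▸ this]
    have h4 : Real.sqrt (T - t) ≤ g * Real.sqrt ν / (2 * K) := by
      have hTtρ : T - t ≤ ρ := by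
        have : T - ρ ≤ t := (le_max_right _ _).trans ht.1.le
        linarith
      have hnn : 0 ≤ g * Real.sqrt ν / (2 * K) := by positivity
      calc Real.sqrt (T - t) ≤ Real.sqrt ρ := Real.sqrt_le_sqrt hTtρ
        _ = g * Real.sqrt ν / (2 * K) := by rw [hρdef, Real.sqrt_sq hnn]
    have h5 : K * Real.sqrt (T - t) ≤ g * Real.sqrt ν / 2 := by
      have := mul_le_mul_of_nonneg_left h4 hK0.le
      have e : K * (g * Real.sqrt ν / (2 * K)) = g * Real.sqrt ν / 2 := by
        field_simp
      linarith [e ▸ this]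
    have h6 : 2 * δc = (2 * δ + g / 2) * Real.sqrt ν := by rw [hδcdef]; ring
    have h7 : C * Real.sqrt ν = (2 * δ + g) * Real.sqrt ν := by rw [hCdef, hgdef]; ring
    rw [h7]
    nlinarith [h3, h5, h6, hsν.le]
  exact hF1a ν T C hν hT hC0 hκC u p hsol hLH hdec hrate

/-- **Schema row F-obs is EXCLUDED (kernel)**, from `ScenarioCensus.row_F1a_excluded`. [folklore] -/
theorem rowFobs_holds : Row_Fobs := rowFobs_of_rowF1a ScenarioCensus.row_F1a_excluded

/-! ## §5 Instances, structural theorems, the residual -/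

/-- F-tw ⊂ F-obs (Galilean observers are admissible). [folklore] -/
theorem rowFtw_of_rowFobs (h : Row_Fobs) : Row_Ftw := by
  intro ν T δ hν hT hδ hδlt u p hsol hLH hdec hc
  obtain ⟨c, hqs⟩ := hc
  exact h ν T δ hν hT hδ hδlt (fun _ _ => c) u p hsol hLH hdec
    (fun t₁ _ => hasCharacteristics_const c t₁ T) hqs

/-- F-acc ⊂ F-obs (the Lagrangian observer is admissible). [folklore] -/
theorem rowFacc_of_rowFobs (h : Row_Fobs) : Row_Facc := by
  intro ν T δ hν hT hδ hδlt u p hsol hLH hdec hqs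
  exact h ν T δ hν hT hδ hδlt u u p hsol hLH hdec
    (fun t₁ ht₁ => hasCharacteristics_velocity hν hT hsol hLH hdec ht₁) hqs

/-- F-force = F-acc read through the momentum equation (`∂ₜu + (u·∇)u = νΔu − ∇p`). [folklore] -/
theorem rowFforce_of_rowFacc (h : Row_Facc) : Row_Fforce := by
  intro ν T δ hν hT hδ hδlt u p hsol hLH hdec hF
  obtain ⟨Λ, hev⟩ := hF
  refine h ν T δ hν hT hδ hδlt u p hsol hLH hdec ⟨Λ, ?_⟩
  filter_upwards [hev, Ioo_mem_nhdsLT hT] with t ht ht' x hΛ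
  have hmom := hsol.momentum t ⟨ht'.1.le, ht'.2⟩ x
  simp only [Pi.zero_apply, add_zero] at hmom
  rw [hmom]
  exact ht x hΛ

/-- F1acc ⊂ F-acc (the Type-I rate is not used). [folklore] -/
theorem rowF1acc_of_rowFacc (h : Row_Facc) : Row_F1acc :=
  fun ν T δ hν hT hδ hδlt u p hsol hLH hdec _ hqs => h ν T δ hν hT hδ hδlt u p hsol hLH hdec hqs

/-- **Row F-tw EXCLUDED (kernel).** [folklore] -/
theorem rowFtw_holds : Row_Ftw := rowFtw_of_rowFobs rowFobs_holds

/-- **Row F-acc EXCLUDED (kernel).** [folklore] -/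
theorem rowFacc_holds : Row_Facc := rowFacc_of_rowFobs rowFobs_holds

/-- **Row F-force EXCLUDED (kernel).** [folklore] -/
theorem rowFforce_holds : Row_Fforce := rowFforce_of_rowFacc rowFacc_holds

/-- **Type-I member F1acc EXCLUDED (kernel).** [folklore] -/
theorem rowF1acc_holds : Row_F1acc := rowF1acc_of_rowFacc rowFacc_holds

/-- **OBSERVER UNSTEADINESS of every Clay blow-up** (structural theorem, kernel). [folklore] -/
theorem observerUnsteadiness_holds : ObserverUnsteadiness := by
  intro ν T hν hT b u p hmax hLH hdec hchar δ Λ t₁ hδ hδlt ht₁T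
  by_contra hcon
  push Not at hcon
  have hqs : HasQuasiSteadyTopAlong ν T δ b u := by
    refine ⟨Λ, ?_⟩
    filter_upwards [Ioo_mem_nhdsLT ht₁T] with t ht x hΛ using hcon t ht x hΛ
  exact hmax.2 (rowFobs_holds ν T δ hν hT hδ hδlt b u p hmax.1 hLH hdec hchar hqs)

/-- **THE FORCE FLOOR of every Clay blow-up** (structural theorem, kernel): at fast particles the force
per mass `νΔu − ∇p` exceeds `δ√ν(T−t)^{-3/2}` arbitrarily close to `T`, for every `δ < 9 − 2√15`.
[folklore] -/
theorem forceFloor_holds : ForceFloor := by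
  intro ν T hν hT u p hmax hLH hdec δ Λ t₁ hδ hδlt ht₁T
  by_contra hcon
  push Not at hcon
  have hF : ∃ Λ : ℝ, ∀ᶠ t in 𝓝[<] T, ∀ x, Λ < ‖u t x‖ →
      ‖ν • Δ (u t) x - gradient (p t) x‖ ≤ δ * Real.sqrt ν / ((T - t) * Real.sqrt (T - t)) := by
    refine ⟨Λ, ?_⟩
    filter_upwards [Ioo_mem_nhdsLT ht₁T] with t ht x hΛ using hcon t ht x hΛ
  exact hmax.2 (rowFforce_holds ν T δ hν hT hδ hδlt u p hmax.1 hLH hdec hF)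

/-- **The split**: Type-I member + residual ⇒ row F1. [folklore] -/
theorem rowF1_of (hD : Row_F1acc) (hR : TypeIBallisticity) : ScenarioCensus.Row_F1 := by
  unfold ScenarioCensus.Row_F1
  intro ν T hν hT u p hsol hLH hdec hTI
  by_contra hext
  obtain ⟨δ, hδ, hδlt, hqs⟩ := hR ν T hν hT u p ⟨hsol, hext⟩ hLH hdec hTI
  exact hext (hD ν T δ hν hT hδ hδlt u p hsol hLH hdec hTI hqs)

/-- The residual is a consequence of the row (vacuously). [folklore] -/
theorem typeIBallisticity_of_rowF1 (h : ScenarioCensus.Row_F1) : TypeIBallisticity :=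
  fun ν T hν hT u p hmax hLH hdec hTI => (hmax.2 (h ν T hν hT u p hmax.1 hLH hdec hTI)).elim

/-- **The residual is EXACTLY row F1** (declared equivalence, kernel). [folklore] -/
theorem typeIBallisticity_iff_rowF1 : TypeIBallisticity ↔ ScenarioCensus.Row_F1 :=
  ⟨fun hR => rowF1_of rowF1acc_holds hR, typeIBallisticity_of_rowF1⟩

/-- **Composition concluding the target BY NAME.** [folklore] -/
theorem rowF1_of_typeIBallisticity : TypeIBallisticity → ScenarioCensus.Row_F1 :=
  typeIBallisticity_iff_rowF1.1

end Summit.NavierStokesRegularity.NavierStokesRegularity.Theorems.ScenarioCensus.ObserverTop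

end
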